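import Summits.ResolutionOfSingularities.ResolutionOfSingularities.Theorems.RadicialJungCleanModelsLens5TFrameModelInf
import HarnessLib

/-!
# Route `RadicialJung`, crux `CleanModels` (stmt-15917): T″ port part 8/10 — §G∞ PORT 4′_∞ `port_regularParameterInf`
PORT (lead `res-B-lead-1` g8) of res-B-lens-5's T″ theorem module (HOME `B/res-B-lens-5/g14/PORTALPHA_TPrimeInf_theorem_module.lean` 48c5cb0bf6ec7b34,
from `Cruxes/DescentPerfectToAll/Lens5_TPrimeInf.lean` rev 3) §G∞, VERBATIM; provenance note in `…Lens5TFrameSepCurrency.lean`.  OURS · counted 0 · nothing here proves resolution in char `p`. -/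
set_option linter.dupNamespace false -- mandated namespace of this single-conjunct summit
noncomputable section
section
open IsLocalRing Literature.AlgebraicGeometry.Resolution Summit.ResolutionOfSingularities.ResolutionOfSingularities.Theorems.RadicialJung.CleanModels Summit.ResolutionOfSingularities.ResolutionOfSingularities.Theorems.RadicialJung.CleanModels.Lens5 Summit.ResolutionOfSingularities.ResolutionOfSingularities.Theorems.RadicialJung.CleanModels.Lens5.PRankTwoCurrency Summit.ResolutionOfSingularities.ResolutionOfSingularities.Theorems.RadicialJung.CleanModels.Lens5.PRankTwoAssembly Summit.ResolutionOfSingularities.ResolutionOfSingularities.Theorems.RadicialJungCleanModels.Lens5RegularityCriterion Summit.ResolutionOfSingularities.ResolutionOfSingularities.Theorems.RadicialJungCleanModels.Lens5ChartSurjection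
namespace Summit.ResolutionOfSingularities.ResolutionOfSingularities.Theorems.RadicialJungCleanModels.Lens5TFrame

/-- **PORT 4′_∞ (regular parameter in the twist field, base of ARBITRARY `p`-rank).**  Port 4′ with the graded structure
`T⁺ = Σ_fin B_s T₀` on FINITELY SUPPORTED sums (`hTspan`, `T₀ ⊆ M`) and RG on finite subfamilies; same conclusion.  Proof = Port 4b
(a)–(e) verbatim, then the tail (f)″ run on the COMMON finite support `S₀ := ⋃_{e ∈ supp q} supp(λ_e)` of the coefficients of the
regular parameter `ψ = Σ_e λ_e u^e`: `ψ = Σ_{s ∈ S₀} B_s ψ_s`, `ψ_s ∈ T₀[u_{≥ρ}] ⊆ S ∩ M`, `v(ψ) = max v(ψ_s) < 1` puts every `ψ_s` in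
`𝔪_S`, and `ψ ∉ 𝔪_S²` forces some `ψ_s ∉ 𝔪_S²`.  PROVED. [folklore] -/
theorem port_regularParameterInf (p : ℕ) [Fact p.Prime] {k : Type} [Field k] [CharP k p]
    {K : Type} [Field K] [Algebra k K] (O : ValuationSubring K) (A : Subalgebra k K)
    (hAO : A.toSubring ≤ O.toSubring) (hAfg : A.FG) [IsFractionRing A K] (hdimA : ringKrullDim A ≤ 3)
    (hdim3 : ringKrullDim (locAtCentre A.toSubring O) = 3)
    (hzd : ∀ (T : Subring K) (hT : T ≤ O.toSubring), A.toSubring ≤ T → (subringCentre T O hT).IsMaximal)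
    (M : Subfield K) (A₂ : Subalgebra k K) (hA₂O : A₂.toSubring ≤ O.toSubring) (hA₂fg : A₂.FG)
    (_hApA₂ : ∀ a ∈ A, a ^ p ∈ A₂)
    {S : Type} (b : S → k) (T₀ : Subring K) (hT₀M : ∀ r : K, r ∈ T₀ → r ∈ M)
    (hT₀S : T₀ ≤ locAtCentre A₂.toSubring O)
    (hTspan : ∀ r : K, r ∈ locAtCentre A₂.toSubring O →
      ∃ (s : Finset S) (c : S → K), (∀ i, c i ∈ T₀) ∧ (∀ i ∉ s, c i = 0) ∧
        r = ∑ i ∈ s, c i * algebraMap k K (b i))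
    (hRG : ∀ (s : Finset S) (c : ↥s → K), (∀ i, c i ∈ M) →
      O.valuation (∑ i : ↥s, c i * algebraMap k K (b i)) = Finset.univ.sup (fun i => O.valuation (c i)))
    (hreg₂ : IsRegularLocalRing (locAtCentre A₂.toSubring O)) (z : Fin 3 → locAtCentre A₂.toSubring O)
    (hz : Ideal.span (Set.range z) = IsLocalRing.maximalIdeal (locAtCentre A₂.toSubring O))
    (_hdimT : ringKrullDim (locAtCentre A₂.toSubring O) = 3)
    (t : Finset K) (ht : Algebra.adjoin k (t : Set K) = A)
    (ρ : ℕ) (hρ : ρ = 1 ∨ ρ = 2) (u : Fin 3 → K) (hu0 : ∀ j, u j ≠ 0)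
    (hupos : ∀ j : Fin 3, (j : ℕ) < ρ → O.valuation (u j) < 1)
    (huzero : ∀ j : Fin 3, ρ ≤ (j : ℕ) → O.valuation (u j) = 1)
    (huM : ∀ j : Fin 3, ρ ≤ (j : ℕ) → u j ∈ M)
    (hzu : ∀ i : Fin 3, ∃ (ε : K) (d : Fin 3 → ℤ), ε ∈ locAtCentre A₂.toSubring O ∧ O.valuation ε = 1 ∧
      (∀ j : Fin 3, (j : ℕ) < ρ → 0 ≤ d j) ∧ (∃ j : Fin 3, (j : ℕ) < ρ ∧ 0 < d j) ∧ ((z i : K)) = ε * ∏ j, u j ^ d j)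
    {ι : Type} [Fintype ι]
    (htu : ∀ a ∈ t, ∃ (ν : ι → K) (d : ι → Fin 3 → ℤ),
      (∀ l, ν l = 0 ∨ (ν l ∈ locAtCentre A₂.toSubring O ∧ O.valuation (ν l) = 1)) ∧
      (∀ l, ∀ j : Fin 3, (j : ℕ) < ρ → 0 ≤ d l j) ∧ a = ∑ l, ν l * ∏ j, u j ^ d l j) :
    ∃ (A'' : Subalgebra k K), A''.toSubring ≤ O.toSubring ∧ A ≤ A'' ∧ A''.FG ∧
      ∃ (_ : IsRegularLocalRing (locAtCentre A''.toSubring O)) (ψ : locAtCentre A''.toSubring O),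
        ψ ∈ IsLocalRing.maximalIdeal (locAtCentre A''.toSubring O) ∧
        ψ ∉ (IsLocalRing.maximalIdeal (locAtCentre A''.toSubring O)) ^ 2 ∧ (ψ : K) ∈ M := by
  classical
  /- (rev 4, res-B-lens-5 g10) PORT 4 PROVED — memo §13 (a)–(f) with ONE simplification: the maximality of `𝔫` (§13 (c1), Zariski) is
  not needed; `P := κ_T[U]_𝔫` at the PRIME `𝔫 = F⁻¹(𝔪)` is a regular local domain whose dimension is pinned to `3 - ρ` by the surjection
  `P ↠ S⧸𝔞` and Krull (`localization_mvPolynomial_regular_of_surjective`). -/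
  have hρ3 : ρ ≤ 3 := by rcases hρ with rfl | rfl <;> norm_num
  obtain ⟨gens₂, hgens₂⟩ := hA₂fg
  have hk : ∀ c : k, algebraMap k K c ∈ A₂ := fun c => A₂.algebraMap_mem c
  have hgensA₂ : ∀ g ∈ gens₂, g ∈ A₂ := fun g hg => by
    rw [← hgens₂]; exact Algebra.subset_adjoin (Finset.mem_coe.mpr hg)
  have htA : ∀ a ∈ t, a ∈ A := fun a ha => by
    rw [← ht]; exact Algebra.subset_adjoin (Finset.mem_coe.mpr ha)
  have huO : ∀ j, u j ∈ O := fun j => (O.valuation_le_one_iff _).mp (by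
    by_cases hj : (j : ℕ) < ρ
    · exact (hupos j hj).le
    · exact (huzero j (not_lt.mp hj)).le)
  have huinvO : ∀ j : Fin 3, ρ ≤ (j : ℕ) → (u j)⁻¹ ∈ O := fun j hj =>
    (O.valuation_le_one_iff _).mp (by rw [map_inv₀, huzero j hj, inv_one])
  -- §13 (a): the chart algebra `A'' = k[gens A₂, u, u_{≥ρ}⁻¹, t]` and its local ring `S = locAtCentre A'' O`
  set Z : Finset (Fin 3) := Finset.univ.filter (fun j => ρ ≤ (j : ℕ)) with hZdef
  have hZ : ∀ j : Fin 3, j ∈ Z ↔ ρ ≤ (j : ℕ) := fun j => by simp [hZdef]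
  set G : Finset K := gens₂ ∪ Finset.univ.image u ∪ Z.image (fun j => (u j)⁻¹) ∪ t with hGdef
  have hGgens : ∀ g ∈ gens₂, g ∈ G := fun g hg => by
    rw [hGdef]; exact Finset.mem_union_left _ (Finset.mem_union_left _ (Finset.mem_union_left _ hg))
  have hGu : ∀ j, u j ∈ G := fun j => by
    rw [hGdef]
    exact Finset.mem_union_left _ (Finset.mem_union_left _ (Finset.mem_union_right _
      (Finset.mem_image.mpr ⟨j, Finset.mem_univ _, rfl⟩)))
  have hGuinv : ∀ j : Fin 3, ρ ≤ (j : ℕ) → (u j)⁻¹ ∈ G := fun j hj => by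
    rw [hGdef]
    exact Finset.mem_union_left _ (Finset.mem_union_right _ (Finset.mem_image.mpr ⟨j, (hZ j).mpr hj, rfl⟩))
  have hGt : ∀ a ∈ t, a ∈ G := fun a ha => by rw [hGdef]; exact Finset.mem_union_right _ ha
  have hGcases : ∀ x ∈ G, x ∈ gens₂ ∨ (∃ j, x = u j) ∨ (∃ j : Fin 3, ρ ≤ (j : ℕ) ∧ x = (u j)⁻¹) ∨ x ∈ t := by
    intro x hx
    rw [hGdef] at hx
    rcases Finset.mem_union.mp hx with hx | hx
    · rcases Finset.mem_union.mp hx with hx | hx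
      · rcases Finset.mem_union.mp hx with hx | hx
        · exact Or.inl hx
        · obtain ⟨j, -, rfl⟩ := Finset.mem_image.mp hx
          exact Or.inr (Or.inl ⟨j, rfl⟩)
      · obtain ⟨j, hj, rfl⟩ := Finset.mem_image.mp hx
        exact Or.inr (Or.inr (Or.inl ⟨j, (hZ j).mp hj, rfl⟩))
    · exact Or.inr (Or.inr (Or.inr hx))
  set A'' : Subalgebra k K := Algebra.adjoin k (G : Set K) with hA''def
  have hGA'' : ∀ x ∈ G, x ∈ A'' := fun x hx => Algebra.subset_adjoin (Finset.mem_coe.mpr hx)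
  let Oₖ : Subalgebra k K :=
    { O.toSubring with algebraMap_mem' := fun c => hA₂O (A₂.algebraMap_mem c) }
  have hGO : (G : Set K) ⊆ (Oₖ : Set K) := by
    intro x hx
    change x ∈ O
    rcases hGcases x (Finset.mem_coe.mp hx) with hx | ⟨j, rfl⟩ | ⟨j, hj, rfl⟩ | hx
    · exact hA₂O (hgensA₂ x hx)
    · exact huO j
    · exact huinvO j hj
    · exact hAO (htA x hx)
  have hA''O : A''.toSubring ≤ O.toSubring := fun x hx => (Algebra.adjoin_le hGO : A'' ≤ Oₖ) hx
  have hAA'' : A ≤ A'' := by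
    rw [← ht]; exact Algebra.adjoin_le fun x hx => hGA'' x (hGt x (Finset.mem_coe.mp hx))
  have hA₂A'' : A₂ ≤ A'' := by
    rw [← hgens₂]; exact Algebra.adjoin_le fun x hx => hGA'' x (hGgens x (Finset.mem_coe.mp hx))
  have hA''fg : A''.FG := ⟨G, hA''def.symm⟩
  have huA'' : ∀ j, u j ∈ A'' := fun j => hGA'' _ (hGu j)
  have huS : ∀ j, u j ∈ locAtCentre A''.toSubring O := fun j => le_locAtCentre _ O (huA'' j)
  have hTS : locAtCentre A₂.toSubring O ≤ locAtCentre A''.toSubring O := locAtCentre_mono O (fun x hx => hA₂A'' hx)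
  haveI hSloc : IsLocalRing (locAtCentre A''.toSubring O) := isLocalRing_locAtCentre hA''O
  haveI : IsLocalization.AtPrime (locAtCentre A''.toSubring O) (subringCentre A''.toSubring O hA''O) :=
    isLocalization_locAtCentre hA''O
  letI : Algebra k A''.toSubring := inferInstanceAs (Algebra k A'')
  haveI : Algebra.FiniteType k A''.toSubring := (A''.fg_iff_finiteType.mp hA''fg : Algebra.FiniteType k A'')
  haveI hSnoeth : IsNoetherianRing (locAtCentre A''.toSubring O) :=
    IsLocalization.isNoetherianRing (subringCentre A''.toSubring O hA''O).primeCompl (locAtCentre A''.toSubring O)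
      (Algebra.FiniteType.isNoetherianRing k A''.toSubring)
  -- `dim S = 3`: the centre is closed (hzd) and `dim A'' = dim A = 3`
  have hdimAeq : ringKrullDim A = 3 := ringKrullDim_eq_three_of_locAtCentre O A hAO hdimA hdim3
  have hdimA'' : ringKrullDim A'' = 3 := by
    rw [Summit.ResolutionOfSingularities.ResolutionOfSingularities.Theorems.RadicialJung.CleanModels.ringKrullDim_eq_of_fg_of_le
      hAfg hA''fg hAA'', hdimAeq]
  have hmaxS : (subringCentre A''.toSubring O hA''O).IsMaximal := hzd A''.toSubring hA''O (fun x hx => hAA'' hx)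
  have hdimS : ringKrullDim (locAtCentre A''.toSubring O) = 3 := by
    rw [Summit.ResolutionOfSingularities.ResolutionOfSingularities.Theorems.RadicialJung.CleanModels.ringKrullDim_locAtCentre_eq_of_isMaximal
      A'' hA''fg O hA''O hmaxS, hdimA'']
  have hdimS3 : ringKrullDim (locAtCentre A''.toSubring O) = ((3 : ℕ) : WithBot ℕ∞) := by rw [hdimS]; norm_cast
  -- §13 (b): `𝔞 := (u_{<ρ})` contains `𝔪_T · S`
  set uS : Fin 3 → locAtCentre A''.toSubring O := fun j => ⟨u j, huS j⟩ with huSdef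
  set uρ : Fin ρ → locAtCentre A''.toSubring O := fun i => uS (Fin.castLE hρ3 i) with huρdef
  have huρ : ∀ i, uρ i ∈ maximalIdeal (locAtCentre A''.toSubring O) := fun i =>
    (mem_maximalIdeal_locAtCentre_iff hA''O _).mpr (hupos (Fin.castLE hρ3 i) (by simp))
  have huS𝔞 : ∀ j : Fin 3, (j : ℕ) < ρ → uS j ∈ Ideal.span (Set.range uρ) := fun j hj =>
    Ideal.subset_span ⟨⟨j, hj⟩, congrArg uS (Fin.ext rfl)⟩
  set ι : locAtCentre A₂.toSubring O →+* locAtCentre A''.toSubring O := Subring.inclusion hTS with hιdef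
  have hιval : ∀ a, ((ι a : locAtCentre A''.toSubring O) : K) = a := fun a => rfl
  have hzS : ∀ i : Fin 3, ι (z i) ∈ Ideal.span (Set.range uρ) := by
    intro i
    obtain ⟨ε, d, hεT, hεv, hdnn, ⟨j₀, hj₀, hdj₀⟩, hzi⟩ := hzu i
    set d' : Fin 3 → ℤ := Function.update d j₀ (d j₀ - 1) with hd'def
    have hd'j₀ : d' j₀ = d j₀ - 1 := by rw [hd'def, Function.update_self]
    have hd'ne : ∀ j, j ≠ j₀ → d' j = d j := fun j hj => by rw [hd'def, Function.update_of_ne hj]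
    have hd'nn : ∀ j : Fin 3, (j : ℕ) < ρ → 0 ≤ d' j := by
      intro j hj
      by_cases hjj : j = j₀
      · rw [hjj, hd'j₀]; omega
      · rw [hd'ne j hjj]; exact hdnn j hj
    have hw'mem : ε * ∏ j, u j ^ d' j ∈ locAtCentre A''.toSubring O := by
      refine mul_mem (hTS hεT) (prod_mem fun j _ => ?_)
      by_cases hj : (j : ℕ) < ρ
      · exact zpow_mem_of_nonneg (huS j) (hd'nn j hj)
      · exact zpow_mem_of_inv_mem (huS j) (inv_mem_locAtCentre (huS j) (huzero j (not_lt.mp hj))) (d' j)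
    have he : ∏ j ∈ Finset.univ.erase j₀, u j ^ d' j = ∏ j ∈ Finset.univ.erase j₀, u j ^ d j :=
      Finset.prod_congr rfl fun j hj => by rw [hd'ne j (Finset.ne_of_mem_erase hj)]
    have hsplit : ε * ∏ j, u j ^ d j = (ε * ∏ j, u j ^ d' j) * u j₀ := by
      rw [← Finset.mul_prod_erase Finset.univ (fun j => u j ^ d j) (Finset.mem_univ j₀),
        ← Finset.mul_prod_erase Finset.univ (fun j => u j ^ d' j) (Finset.mem_univ j₀)]
      show ε * (u j₀ ^ d j₀ * ∏ j ∈ Finset.univ.erase j₀, u j ^ d j) =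
        ε * (u j₀ ^ d' j₀ * ∏ j ∈ Finset.univ.erase j₀, u j ^ d' j) * u j₀
      rw [he, hd'j₀, zpow_sub_one₀ (hu0 j₀)]
      have h0 : (u j₀)⁻¹ * u j₀ = 1 := inv_mul_cancel₀ (hu0 j₀)
      calc ε * (u j₀ ^ d j₀ * ∏ j ∈ Finset.univ.erase j₀, u j ^ d j)
          = ε * (u j₀ ^ d j₀ * ((u j₀)⁻¹ * u j₀) * ∏ j ∈ Finset.univ.erase j₀, u j ^ d j) := by rw [h0, mul_one]
        _ = ε * (u j₀ ^ d j₀ * (u j₀)⁻¹ * ∏ j ∈ Finset.univ.erase j₀, u j ^ d j) * u j₀ := by ring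
    have hιz : ι (z i) = ⟨ε * ∏ j, u j ^ d' j, hw'mem⟩ * uS j₀ := by
      apply Subtype.ext
      show ((z i : K)) = (ε * ∏ j, u j ^ d' j) * u j₀
      rw [hzi, hsplit]
    rw [hιz]
    exact Ideal.mul_mem_left _ _ (huS𝔞 j₀ hj₀)
  -- §13 (c): `E := S ⧸ 𝔞` is local; `F₁ : κ_T → E` (`𝔪_T ↦ 0`), `F : κ_T[U_{≥ρ}] → E`, `𝔫 := F⁻¹ 𝔪_E`, `P := κ_T[U]_𝔫`
  have h𝔞m : Ideal.span (Set.range uρ) ≤ maximalIdeal (locAtCentre A''.toSubring O) := by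
    rw [Ideal.span_le]; rintro _ ⟨i, rfl⟩; exact huρ i
  have h𝔞top : Ideal.span (Set.range uρ) ≠ ⊤ := fun h =>
    (maximalIdeal.isMaximal (locAtCentre A''.toSubring O)).ne_top (top_le_iff.mp (h ▸ h𝔞m))
  haveI : Nontrivial (locAtCentre A''.toSubring O ⧸ Ideal.span (Set.range uρ)) :=
    Ideal.Quotient.nontrivial_iff.mpr h𝔞top
  haveI : IsLocalRing (locAtCentre A''.toSubring O ⧸ Ideal.span (Set.range uρ)) :=
    IsLocalRing.of_surjective' (Ideal.Quotient.mk _) Ideal.Quotient.mk_surjective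
  have hkill : ∀ a ∈ maximalIdeal (locAtCentre A₂.toSubring O),
      ((Ideal.Quotient.mk (Ideal.span (Set.range uρ))).comp ι) a = 0 := by
    have hmap : (maximalIdeal (locAtCentre A₂.toSubring O)).map ι ≤ Ideal.span (Set.range uρ) := by
      rw [← hz, Ideal.map_span, Ideal.span_le]
      rintro _ ⟨_, ⟨i, rfl⟩, rfl⟩
      exact hzS i
    intro a ha
    rw [RingHom.comp_apply, Ideal.Quotient.eq_zero_iff_mem]
    exact hmap (Ideal.mem_map_of_mem ι ha)
  set F₁ : ResidueField (locAtCentre A₂.toSubring O) →+* (locAtCentre A''.toSubring O ⧸ Ideal.span (Set.range uρ)) :=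
    Ideal.Quotient.lift (maximalIdeal (locAtCentre A₂.toSubring O))
      ((Ideal.Quotient.mk (Ideal.span (Set.range uρ))).comp ι) hkill with hF₁def
  have hF₁ : ∀ a, F₁ (residue _ a) = Ideal.Quotient.mk _ (ι a) := fun a => by
    rw [hF₁def]; exact Ideal.Quotient.lift_mk _ _ _
  set zI : Fin (3 - ρ) → Fin 3 := fun i => ⟨ρ + (i : ℕ), by have := i.2; omega⟩ with hzIdef
  have hzIval : ∀ i, ((zI i : Fin 3) : ℕ) = ρ + (i : ℕ) := fun i => rfl
  have hzIρ : ∀ i, ρ ≤ ((zI i : Fin 3) : ℕ) := fun i => by rw [hzIval]; omega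
  set F : MvPolynomial (Fin (3 - ρ)) (ResidueField (locAtCentre A₂.toSubring O)) →+*
      (locAtCentre A''.toSubring O ⧸ Ideal.span (Set.range uρ)) :=
    MvPolynomial.eval₂Hom F₁ (fun i => Ideal.Quotient.mk (Ideal.span (Set.range uρ)) (uS (zI i))) with hFdef
  have hFC : ∀ r, F (MvPolynomial.C r) = F₁ r := fun r => by rw [hFdef]; exact MvPolynomial.eval₂Hom_C _ _ r
  have hFX : ∀ i, F (MvPolynomial.X i) = Ideal.Quotient.mk (Ideal.span (Set.range uρ)) (uS (zI i)) := fun i => by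
    rw [hFdef]; exact MvPolynomial.eval₂Hom_X' _ _ i
  set 𝔫 : Ideal (MvPolynomial (Fin (3 - ρ)) (ResidueField (locAtCentre A₂.toSubring O))) :=
    (maximalIdeal (locAtCentre A''.toSubring O ⧸ Ideal.span (Set.range uρ))).comap F with h𝔫def
  haveI h𝔫prime : 𝔫.IsPrime := Ideal.IsPrime.comap F
  obtain ⟨hunit, h𝔫u⟩ := primeCompl_comap_maximalIdeal F
  -- the normal form on `A''`: `R₀ := T[u] ⊆ S`, `w := ∏_{j ≥ ρ} u_j`, every `x ∈ A''` has `x · w^N ∈ R₀`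
  set R₀ : Subring K := Subring.closure ((locAtCentre A₂.toSubring O : Set K) ∪ Set.range u) with hR₀def
  have hTR₀ : ∀ x ∈ locAtCentre A₂.toSubring O, x ∈ R₀ := fun x hx => by
    rw [hR₀def]; exact Subring.subset_closure (Or.inl hx)
  have huR₀ : ∀ j, u j ∈ R₀ := fun j => by rw [hR₀def]; exact Subring.subset_closure (Or.inr ⟨j, rfl⟩)
  have hR₀S : R₀ ≤ locAtCentre A''.toSubring O := by
    rw [hR₀def, Subring.closure_le]
    rintro x (hx | ⟨j, rfl⟩)
    · exact hTS hx
    · exact huS j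
  set w : K := ∏ j ∈ Z, u j with hwdef
  have hwv : O.valuation w = 1 := by
    rw [hwdef, map_prod]; exact Finset.prod_eq_one fun j hj => huzero j ((hZ j).mp hj)
  have hwR₀ : w ∈ R₀ := by rw [hwdef]; exact prod_mem fun j _ => huR₀ j
  have huinv : ∀ j ∈ Z, NF R₀ w (u j)⁻¹ := by
    intro j hj
    refine ⟨1, ?_⟩
    rw [pow_one, hwdef, ← Finset.mul_prod_erase Z u hj, inv_mul_cancel_left₀ (hu0 j)]
    exact prod_mem fun i _ => huR₀ i
  have hNF : ∀ x ∈ A'', NF R₀ w x := by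
    intro x hx
    rw [hA''def] at hx
    induction hx using Algebra.adjoin_induction with
    | mem x hx =>
      rcases hGcases x (Finset.mem_coe.mp hx) with hx | ⟨j, rfl⟩ | ⟨j, hj, rfl⟩ | hx
      · exact NF.of_mem (hTR₀ x (le_locAtCentre _ O (hgensA₂ x hx)))
      · exact NF.of_mem (huR₀ j)
      · exact huinv j ((hZ j).mpr hj)
      · obtain ⟨ν, d, hν, hd, rfl⟩ := htu x hx
        refine NF.sum _ _ hwR₀ fun l _ => NF.mul ?_ (NF.prod _ _ fun j _ => ?_)
        · rcases hν l with h0 | ⟨hνT, -⟩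
          · rw [h0]; exact NF.zero
          · exact NF.of_mem (hTR₀ _ hνT)
        · by_cases hj : (j : ℕ) < ρ
          · exact (NF.of_mem (huR₀ j)).zpow_of_nonneg (hd l j hj)
          · exact (NF.of_mem (huR₀ j)).zpow (huinv j ((hZ j).mpr (not_lt.mp hj))) (d l j)
    | algebraMap c => exact NF.of_mem (hTR₀ _ (le_locAtCentre _ O (hk c)))
    | add x y hx hy ihx ihy => exact ihx.add hwR₀ ihy
    | mul x y hx hy ihx ihy => exact ihx.mul ihy
  -- (c2) normal form of the fractions `s = y / x ∈ S` and the preimages under `F`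
  have hloc : ∀ s : locAtCentre A''.toSubring O, ∃ b c : locAtCentre A''.toSubring O,
      b ∈ {s : locAtCentre A''.toSubring O | (s : K) ∈ R₀} ∧ c ∈ {s : locAtCentre A''.toSubring O | (s : K) ∈ R₀} ∧
      IsUnit (Ideal.Quotient.mk (Ideal.span (Set.range uρ)) c) ∧ s * c - b ∈ Ideal.span (Set.range uρ) := by
    intro s
    obtain ⟨y, hy, x, hx, hxv, hs⟩ := (mem_locAtCentre_iff).mp s.2
    obtain ⟨N₁, hN₁⟩ := hNF y hy
    obtain ⟨N₂, hN₂⟩ := hNF x hx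
    have hb : y * w ^ N₁ * w ^ N₂ ∈ R₀ := R₀.mul_mem hN₁ (R₀.pow_mem hwR₀ N₂)
    have hc : x * w ^ N₂ * w ^ N₁ ∈ R₀ := R₀.mul_mem hN₂ (R₀.pow_mem hwR₀ N₁)
    refine ⟨⟨_, hR₀S hb⟩, ⟨_, hR₀S hc⟩, hb, hc, ?_, ?_⟩
    · refine IsUnit.map _ (notMem_maximalIdeal.mp fun hm => ?_)
      have hlt : O.valuation (x * w ^ N₂ * w ^ N₁) < 1 := (mem_maximalIdeal_locAtCentre_iff hA''O _).mp hm
      rw [map_mul, map_mul, map_pow, map_pow, hxv, hwv, one_pow, one_pow, mul_one, mul_one] at hlt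
      exact lt_irrefl _ hlt
    · have h0 : x ≠ 0 := ne_zero_of_valuation_eq_one hxv
      have hzero : s * ⟨_, hR₀S hc⟩ - ⟨_, hR₀S hb⟩ = (0 : locAtCentre A''.toSubring O) := by
        apply Subtype.ext
        show (s : K) * (x * w ^ N₂ * w ^ N₁) - y * w ^ N₁ * w ^ N₂ = 0
        rw [hs, sub_eq_zero]
        calc y / x * (x * w ^ N₂ * w ^ N₁) = (y / x * x) * (w ^ N₂ * w ^ N₁) := by ring
          _ = y * w ^ N₁ * w ^ N₂ := by rw [div_mul_cancel₀ y h0]; ring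
      rw [hzero]; exact Ideal.zero_mem _
  have hF : ∀ b ∈ {s : locAtCentre A''.toSubring O | (s : K) ∈ R₀},
      Ideal.Quotient.mk (Ideal.span (Set.range uρ)) b ∈ F.range := by
    have key : ∀ x ∈ R₀, ∃ hx : x ∈ locAtCentre A''.toSubring O,
        Ideal.Quotient.mk (Ideal.span (Set.range uρ)) ⟨x, hx⟩ ∈ F.range := by
      intro x hx
      rw [hR₀def] at hx
      induction hx using Subring.closure_induction with
      | mem x hx =>
        rcases hx with hx | ⟨j, rfl⟩
        · refine ⟨hTS hx, RingHom.mem_range.mpr ⟨MvPolynomial.C (residue _ ⟨x, hx⟩), ?_⟩⟩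
          rw [hFC, hF₁]
          rfl
        · by_cases hj : (j : ℕ) < ρ
          · refine ⟨huS j, RingHom.mem_range.mpr ⟨0, ?_⟩⟩
            rw [map_zero]
            exact (Ideal.Quotient.eq_zero_iff_mem.mpr (huS𝔞 j hj)).symm
          · have hj3 : (j : ℕ) - ρ < 3 - ρ := by have := j.2; omega
            refine ⟨huS j, RingHom.mem_range.mpr ⟨MvPolynomial.X ⟨(j : ℕ) - ρ, hj3⟩, ?_⟩⟩
            rw [hFX]
            have hjj : zI ⟨(j : ℕ) - ρ, hj3⟩ = j := Fin.ext (by rw [hzIval]; simp only; omega)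
            rw [hjj]
      | zero => exact ⟨Subring.zero_mem _, RingHom.mem_range.mpr ⟨0, by rw [map_zero]; exact (map_zero _).symm⟩⟩
      | one => exact ⟨Subring.one_mem _, RingHom.mem_range.mpr ⟨1, by rw [map_one]; exact (map_one _).symm⟩⟩
      | add x y hx hy ihx ihy =>
        obtain ⟨hxS, hx'⟩ := ihx
        obtain ⟨hyS, hy'⟩ := ihy
        obtain ⟨qx, hqx⟩ := RingHom.mem_range.mp hx'
        obtain ⟨qy, hqy⟩ := RingHom.mem_range.mp hy'
        exact ⟨add_mem hxS hyS, RingHom.mem_range.mpr ⟨qx + qy, by rw [map_add, hqx, hqy, ← map_add]; rfl⟩⟩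
      | neg x hx ih =>
        obtain ⟨hxS, hx'⟩ := ih
        obtain ⟨qx, hqx⟩ := RingHom.mem_range.mp hx'
        exact ⟨neg_mem hxS, RingHom.mem_range.mpr ⟨-qx, by rw [map_neg, hqx, ← map_neg]; rfl⟩⟩
      | mul x y hx hy ihx ihy =>
        obtain ⟨hxS, hx'⟩ := ihx
        obtain ⟨hyS, hy'⟩ := ihy
        obtain ⟨qx, hqx⟩ := RingHom.mem_range.mp hx'
        obtain ⟨qy, hqy⟩ := RingHom.mem_range.mp hy'
        exact ⟨mul_mem hxS hyS, RingHom.mem_range.mpr ⟨qx * qy, by rw [map_mul, hqx, hqy, ← map_mul]; rfl⟩⟩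
    intro b hb
    obtain ⟨hbS, h⟩ := key (b : K) hb
    exact h
  have hf : Function.Surjective (IsLocalization.lift (S := Localization.AtPrime 𝔫) hunit) :=
    lift_surjective_of_normal_form (P := Localization.AtPrime 𝔫) _ _ hloc F hF 𝔫 hunit h𝔫u
  -- §13 (d): `P` is a regular local domain of dimension `3 - ρ` (pinned by the surjection)
  have hEdim : ((3 - ρ : ℕ) : WithBot ℕ∞) ≤ ringKrullDim (locAtCentre A''.toSubring O ⧸ Ideal.span (Set.range uρ)) :=
    natCast_sub_le_ringKrullDim_quotient_span (n := 3) hdimS3 uρ huρ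
  obtain ⟨hPreg, hPdom, hdimP⟩ :=
    localization_mvPolynomial_regular_of_surjective (ResidueField (locAtCentre A₂.toSubring O)) (3 - ρ) 𝔫 _ hf hEdim
  -- §13 (e): the criterion — `S` is REGULAR and lifts of regular parameters of `P` are regular parameters of `S`
  obtain ⟨hregS, -, -, hlift1, hlift2⟩ :=
    regular_of_regular_quotient (n := 3) (ρ := ρ) hdimS3 hρ3 uρ huρ hdimP (IsLocalization.lift hunit) hf
  -- §13 (f): a generator `q ∈ 𝔫` mapping to a regular parameter of `P`, its lift `ψ ∈ T[u_{≥ρ}] ⊆ S`, and `ψ ∈ M`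
  have hdimP0 : ringKrullDim (Localization.AtPrime 𝔫) ≠ 0 := by
    rw [hdimP]
    have h : (3 - ρ : ℕ) ≠ 0 := by omega
    exact_mod_cast h
  obtain ⟨q, hq𝔫, hq1, hq2⟩ := exists_generator_map_not_mem_sq hdimP0 (algebraMap _ (Localization.AtPrime 𝔫))
    (𝔫 : Set (MvPolynomial (Fin (3 - ρ)) (ResidueField (locAtCentre A₂.toSubring O))))
    (by rw [Ideal.span_eq]; exact Localization.AtPrime.map_eq_maximalIdeal)
  have hres : ∀ e : Fin (3 - ρ) →₀ ℕ, ∃ c : locAtCentre A₂.toSubring O, residue _ c = q.coeff e := fun e =>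
    Ideal.Quotient.mk_surjective (q.coeff e)
  choose lam hlam using hres
  set ψ : locAtCentre A''.toSubring O := ∑ e ∈ q.support, ι (lam e) * ∏ i, uS (zI i) ^ (e i) with hψdef
  have hψF : Ideal.Quotient.mk (Ideal.span (Set.range uρ)) ψ = F q := by
    rw [hψdef, map_sum, hFdef, MvPolynomial.coe_eval₂Hom, MvPolynomial.eval₂_eq']
    refine Finset.sum_congr rfl fun e _ => ?_
    rw [map_mul, map_prod, ← hlam e, hF₁]
    simp only [map_pow]
  have hψπ : Ideal.Quotient.mk (Ideal.span (Set.range uρ)) ψ =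
      IsLocalization.lift (S := Localization.AtPrime 𝔫) hunit (algebraMap _ (Localization.AtPrime 𝔫) q) := by
    rw [IsLocalization.lift_eq]; exact hψF
  -- §13 (f)″ GRADED DESCENT (new in PORT 4′): the components of `ψ ∈ T⁺[u_{≥ρ}] = Σ_s B_s T₀[u_{≥ρ}]`
  have hlamspan : ∀ e, ∃ (s : Finset S) (c : S → K), (∀ i, c i ∈ T₀) ∧ (∀ i ∉ s, c i = 0) ∧
      ((lam e : locAtCentre A₂.toSubring O) : K) = ∑ i ∈ s, c i * algebraMap k K (b i) := fun e => hTspan _ (lam e).2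
  choose sc cc hccT₀ hcc0 hcc using hlamspan
  set S₀ : Finset S := q.support.biUnion sc with hS₀def
  have hsub : ∀ e ∈ q.support, sc e ⊆ S₀ := fun e he => Finset.subset_biUnion_of_mem sc he
  have hcc' : ∀ e ∈ q.support, ((lam e : locAtCentre A₂.toSubring O) : K) =
      ∑ i : ↥S₀, cc e i * algebraMap k K (b i) := by
    intro e he
    rw [hcc e, Finset.sum_subset (hsub e he) (fun i _ hi => by rw [hcc0 e i hi, zero_mul]), ← Finset.sum_coe_sort]
  have hT₀S' : ∀ r, r ∈ T₀ → r ∈ locAtCentre A''.toSubring O := fun r hr => hTS (hT₀S hr)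
  have hBS : ∀ s, algebraMap k K (b s) ∈ locAtCentre A''.toSubring O := fun s => hTS (le_locAtCentre _ O (hk (b s)))
  set ψc : ↥S₀ → locAtCentre A''.toSubring O := fun i =>
    ∑ e ∈ q.support, (⟨cc e i, hT₀S' _ (hccT₀ e i)⟩ : locAtCentre A''.toSubring O) * ∏ j, uS (zI j) ^ (e j) with hψcdef
  have hψK : ((ψ : locAtCentre A''.toSubring O) : K) =
      ∑ e ∈ q.support, ((lam e : locAtCentre A₂.toSubring O) : K) * ∏ j, u (zI j) ^ (e j) := by
    rw [hψdef]; push_cast; rfl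
  have hψcK : ∀ i : ↥S₀, ((ψc i : locAtCentre A''.toSubring O) : K) =
      ∑ e ∈ q.support, cc e i * ∏ j, u (zI j) ^ (e j) := by
    intro i; rw [hψcdef]; push_cast; rfl
  have hψsumK : ((ψ : locAtCentre A''.toSubring O) : K) =
      ∑ i : ↥S₀, ((ψc i : locAtCentre A''.toSubring O) : K) * algebraMap k K (b i) := by
    rw [hψK]
    have h1 : ∑ e ∈ q.support, ((lam e : locAtCentre A₂.toSubring O) : K) * ∏ j, u (zI j) ^ (e j) =
        ∑ e ∈ q.support, (∑ i : ↥S₀, cc e i * algebraMap k K (b i)) * ∏ j, u (zI j) ^ (e j) :=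
      Finset.sum_congr rfl fun e he => by rw [hcc' e he]
    rw [h1]
    simp_rw [hψcK, Finset.sum_mul]
    rw [Finset.sum_comm]
    refine Finset.sum_congr rfl fun i _ => Finset.sum_congr rfl fun e _ => ?_
    ring
  have hψS : ψ = ∑ i : ↥S₀, ψc i * (⟨algebraMap k K (b i), hBS i⟩ : locAtCentre A''.toSubring O) := by
    apply Subtype.ext
    rw [hψsumK]; push_cast; rfl
  have hψcM : ∀ i : ↥S₀, ((ψc i : locAtCentre A''.toSubring O) : K) ∈ M := fun i => by
    rw [hψcK]
    exact sum_mem fun e _ => mul_mem (hT₀M _ (hccT₀ e i)) (prod_mem fun j _ => pow_mem (huM _ (hzIρ j)) _)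
  have hψ1 : ψ ∈ maximalIdeal (locAtCentre A''.toSubring O) := hlift1 ψ _ hψπ hq1
  have hψ2 : ψ ∉ (maximalIdeal (locAtCentre A''.toSubring O)) ^ 2 := hlift2 ψ _ hψπ hq2
  have hvψ : O.valuation ((ψ : locAtCentre A''.toSubring O) : K) < 1 := (mem_maximalIdeal_locAtCentre_iff hA''O ψ).mp hψ1
  have hsup : Finset.univ.sup (fun i : ↥S₀ => O.valuation ((ψc i : locAtCentre A''.toSubring O) : K)) < 1 := by
    rw [← hRG S₀ _ hψcM, ← hψsumK]; exact hvψ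
  have hψc1 : ∀ i : ↥S₀, ψc i ∈ maximalIdeal (locAtCentre A''.toSubring O) := fun i =>
    (mem_maximalIdeal_locAtCentre_iff hA''O _).mpr (lt_of_le_of_lt
      (Finset.le_sup (f := fun i : ↥S₀ => O.valuation ((ψc i : locAtCentre A''.toSubring O) : K)) (Finset.mem_univ i)) hsup)
  have hψc2 : ∃ i : ↥S₀, ψc i ∉ (maximalIdeal (locAtCentre A''.toSubring O)) ^ 2 := by
    by_contra hall
    push Not at hall
    exact hψ2 (by rw [hψS]; exact Ideal.sum_mem _ fun i _ => Ideal.mul_mem_right _ _ (hall i))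
  obtain ⟨i₁, hi₁⟩ := hψc2
  exact ⟨A'', hA''O, hAA'', hA''fg, hregS, ψc i₁, hψc1 i₁, hi₁, hψcM i₁⟩
end Summit.ResolutionOfSingularities.ResolutionOfSingularities.Theorems.RadicialJungCleanModels.Lens5TFrame
end
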